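import Mathlib.RingTheory.AdicCompletion.Algebra
import Mathlib.RingTheory.Derivation.Basic
import Mathlib.RingTheory.Etale.Kaehler
import Mathlib.RingTheory.Localization.Module
import Mathlib.RingTheory.TensorProduct.Basic
import HarnessLib

/-!
# Derivations extend to localisations, adic completions and tensor products (Stacks 07PE)

Topic: `Literature/AlgebraicGeometry/Resolution`. Plumbing for the characteristic-`p` half of
Matsumura's Thm. 32.3 (`FormalFibres.lean`, leaf `Matsumura1987_32_3_regular`), whose proof in
the Stacks Project (Tag 07PR) transports a derivation `D : B → B` of a finite algebra `B` over a
complete local ring through "localizing, completing and localizing again" (Stacks, Tag 07PE: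
"Let `R` be a ring. Let `D : R → R` be a derivation. (1) For any ideal `I ⊂ R` the derivation `D`
extends canonically to a derivation `D^∧ : R^∧ → R^∧` on the `I`-adic completion. (2) For any
multiplicative subset `S ⊂ R` the derivation `D` extends uniquely to the localization `S⁻¹R`").
Everything here is PROVED, in the module-valued generality in which it is used:

* `exists_derivation_extend_of_isLocalizedModule` — **07PE (2), module-valued**: a derivation
  `δ : R → N` into an `R`-module extends to `δ' : W⁻¹R → W⁻¹N` with `δ'(r/1) = δ(r)/1`
  (through `Ω_{W⁻¹R} = W⁻¹Ω_R`, Mathlib's `KaehlerDifferential.isLocalizedModule_map`).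
* `derivationAdicCompletion` — **07PE (1), module-valued**: a derivation `δ : A → N` into an
  `A`-module induces, since `δ(I^{n+1}) ⊆ IⁿN` (`derivation_apply_mem_pow_smul_top`), additive
  maps `A/I^{n+1} → N/IⁿN` compatible with the transition maps, hence a derivation
  `δ^ : Â → N̂` of the `I`-adic completion `Â = AdicCompletion I A` into the `Â`-module
  `N̂ = AdicCompletion I N`, with `δ^(a) = δ(a)^` for `a ∈ A` (`derivationAdicCompletion_of`).
* `tensorProductDerivation` — **derivations of a tensor product from a compatible
  pair**: for `R`-algebras `A`, `C`, a derivation `d_A : A → A ⊗_R C` and a derivation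
  `d_C : C → C` which agree on `R` (`d_A(r·1) = 1 ⊗ d_C(r·1)`) glue to a derivation `D` of the
  ring `A ⊗_R C` with `D(a ⊗ c) = (1 ⊗ c)·d_A(a) + a ⊗ d_C(c)` (the universal property
  `Der(A ⊗_R C) = Der(A) ×_{Der(R)} Der(C)` in the form needed; [folklore], e.g. Matsumura
  §25, `Ω_{A ⊗ C} = (Ω_A ⊗ C) ⊕ (A ⊗ Ω_C)` over the base).

## Sources

* The Stacks Project, Tag 07PE (Lemma 15.49.1). [StacksProject]
* H. Matsumura, *Commutative Ring Theory*, CUP 1986, Ex. 25.3 p. 197 [PDF 215] ("a derivation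
  `D` of `A` … can be uniquely extended to the completion"); §25. [Matsumura1987]
-/

noncomputable section

open TensorProduct

namespace Literature.AlgebraicGeometry.Resolution

universe u v w

/- All `ℤ`-algebra (`ℤ`-module) structures on a ring (abelian group) coincide, but Mathlib equips
adic completions, localisations and tensor products with their own instances, which are not
syntactically the generic ones `Ring.toIntAlgebra` / `AddCommGroup.toIntModule`. To keep the
types of the `ℤ`-derivations below uniform (and usable from other files doing the same), we
give the generic instances priority in this file. -/
attribute [local instance 1100] Ring.toIntAlgebra AddCommGroup.toIntModule

/-! ## 1. Derivations into modules extend to localisations (Stacks 07PE (2)) -/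

section Localization

variable {R : Type u} [CommRing R] (W : Submonoid R) (S : Type v) [CommRing S] [Algebra R S]
  [IsLocalization W S] {N : Type w} [AddCommGroup N] [Module R N] {N' : Type*} [AddCommGroup N']
  [Module R N'] [Module S N'] [IsScalarTower R S N'] (f : N →ₗ[R] N') [IsLocalizedModule W f]

include W in
/-- **Derivations into a module extend to localisations** (Stacks 07PE (2), module-valued): for
a derivation `δ : R → N` and a localisation `S = W⁻¹R`, `N' = W⁻¹N`, there is a derivation
`δ' : S → N'` with `δ'(r/1) = δ(r)/1` (namely `δ'(r/w) = (wδ(r) - rδ(w))/w²`), obtained from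
`Ω_{S/ℤ} = W⁻¹Ω_{R/ℤ}`. [cite: StacksProject, Tag 07PE (2)] -/
theorem exists_derivation_extend_of_isLocalizedModule (δ : Derivation ℤ R N) :
    ∃ δ' : Derivation ℤ S N', ∀ r : R, δ' (algebraMap R S r) = f (δ r) := by
  let ℓ : Ω[R⁄ℤ] →ₗ[R] N := δ.liftKaehlerDifferential
  let ℓ' : Ω[S⁄ℤ] →ₗ[S] N' :=
    IsLocalizedModule.mapExtendScalars W (KaehlerDifferential.map ℤ ℤ R S) f S ℓ
  refine ⟨ℓ'.compDer (KaehlerDifferential.D ℤ S), fun r => ?_⟩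
  change ℓ' (KaehlerDifferential.D ℤ S (algebraMap R S r)) = _
  rw [← KaehlerDifferential.map_D ℤ ℤ R S r]
  change IsLocalizedModule.map W (KaehlerDifferential.map ℤ ℤ R S) f ℓ
    (KaehlerDifferential.map ℤ ℤ R S (KaehlerDifferential.D ℤ R r)) = _
  rw [IsLocalizedModule.map_apply]
  change f (ℓ (KaehlerDifferential.D ℤ R r)) = _
  rw [Derivation.liftKaehlerDifferential_comp_D]

end Localization

/-! ## 2. Derivations extend to adic completions (Stacks 07PE (1)) -/

section Completion

variable {A : Type u} [CommRing A] (I : Ideal A) {N : Type v} [AddCommGroup N] [Module A N]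
  (δ : Derivation ℤ A N)

/-- `δ(Iⁿ⁺¹) ⊆ IⁿN` for a derivation `δ : A → N` (Leibniz). [folklore] -/
theorem derivation_apply_mem_pow_smul_top (n : ℕ) {a : A} (ha : a ∈ I ^ (n + 1)) :
    δ a ∈ (I ^ n • ⊤ : Submodule A N) := by
  induction n generalizing a with
  | zero => simp
  | succ n ih =>
    rw [pow_succ] at ha
    refine Submodule.mul_induction_on ha (fun x hx y hy => ?_) (fun x y hx hy => ?_)
    · rw [Derivation.leibniz]
      refine Submodule.add_mem _ (Submodule.smul_mem_smul hx Submodule.mem_top) ?_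
      have h1 : y • δ x ∈ I • (I ^ n • ⊤ : Submodule A N) :=
        Submodule.smul_mem_smul hy (ih hx)
      rwa [← Submodule.smul_assoc, smul_eq_mul, ← pow_succ'] at h1
    · rw [map_add]
      exact Submodule.add_mem _ hx hy

/-- `δ(Iⁿ⁺¹) ⊆ IⁿN`, ideal written as `Iⁿ⁺¹ • ⊤` (the form in which `AdicCompletion I A` is
built). [folklore] -/
theorem derivation_apply_mem_pow_smul_top' (n : ℕ) {a : A}
    (ha : a ∈ (I ^ (n + 1) • ⊤ : Ideal A)) : δ a ∈ (I ^ n • ⊤ : Submodule A N) := by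
  rw [smul_eq_mul, Ideal.mul_top] at ha
  exact derivation_apply_mem_pow_smul_top I δ n ha

/-- The additive map `A/Iⁿ⁺¹ → N/IⁿN` induced by a derivation `δ : A → N`. [folklore] -/
def derivationQuotPowMap (n : ℕ) :
    A ⧸ (I ^ (n + 1) • ⊤ : Ideal A) →+ N ⧸ (I ^ n • ⊤ : Submodule A N) :=
  QuotientAddGroup.lift (I ^ (n + 1) • ⊤ : Ideal A).toAddSubgroup
    ((I ^ n • ⊤ : Submodule A N).mkQ.toAddMonoidHom.comp δ.toLinearMap.toAddMonoidHom)
    fun a ha => by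
      change (I ^ n • ⊤ : Submodule A N).mkQ (δ a) = 0
      rw [Submodule.mkQ_apply, Submodule.Quotient.mk_eq_zero]
      exact derivation_apply_mem_pow_smul_top' I δ n ha

/-- The induced map on a class `[a]` is `[δ a]`. [folklore] -/
@[simp]
theorem derivationQuotPowMap_mk (n : ℕ) (a : A) :
    derivationQuotPowMap I δ n (Ideal.Quotient.mk _ a) = Submodule.Quotient.mk (δ a) :=
  rfl

/-- Compatibility of the maps `A/Iⁿ⁺¹ → N/IⁿN` with the transition maps. [folklore] -/
theorem derivation_transitionMap_quotPowMap {m n : ℕ} (hmn : m ≤ n)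
    (x : A ⧸ (I ^ (n + 1) • ⊤ : Ideal A)) :
    AdicCompletion.transitionMap I N hmn (derivationQuotPowMap I δ n x) =
      derivationQuotPowMap I δ m (AdicCompletion.transitionMap I A (Nat.succ_le_succ hmn) x) := by
  obtain ⟨a, rfl⟩ := Ideal.Quotient.mk_surjective x
  rfl

/-- The underlying function of the extension of `δ` to the adic completion:
`(xₙ)ₙ ↦ (δₙ(xₙ₊₁))ₙ`. [folklore] -/
def derivationAdicCompletionFun (x : AdicCompletion I A) : AdicCompletion I N where
  val n := derivationQuotPowMap I δ n (x.val (n + 1))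
  property {m n} hmn := by
    change AdicCompletion.transitionMap I N hmn (derivationQuotPowMap I δ n (x.val (n + 1))) =
      derivationQuotPowMap I δ m (x.val (m + 1))
    rw [derivation_transitionMap_quotPowMap I δ hmn]
    congr 1
    exact x.property (Nat.succ_le_succ hmn)

/-- Components of the extension. [folklore] -/
@[simp]
theorem derivationAdicCompletionFun_val (x : AdicCompletion I A) (n : ℕ) :
    (derivationAdicCompletionFun I δ x).val n = derivationQuotPowMap I δ n (x.val (n + 1)) :=
  rfl

/-- The extension as an additive map. [folklore] -/
def derivationAdicCompletionAddHom : AdicCompletion I A →+ AdicCompletion I N where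
  toFun := derivationAdicCompletionFun I δ
  map_zero' := by
    ext n
    simp [AdicCompletion.val_zero_apply]
  map_add' x y := by
    ext n
    simp [AdicCompletion.val_add_apply]

/-- In `A/Iⁿ`, the `n`-th component of `x ∈ Â` is the image of its `(n+1)`-st component.
[folklore] -/
theorem adicCompletion_val_eq_transitionMap_val_succ (x : AdicCompletion I A) (n : ℕ) :
    x.val n = AdicCompletion.transitionMap I A n.le_succ (x.val (n + 1)) :=
  (x.property n.le_succ).symm

/-- **Derivations extend to adic completions** (Stacks 07PE (1), module-valued; Matsumura
Ex. 25.3): the derivation `δ^ : Â → N̂` of the `I`-adic completion `Â = AdicCompletion I A` into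
the `Â`-module `N̂ = AdicCompletion I N` induced by a derivation `δ : A → N`, defined componentwise
by the maps `A/Iⁿ⁺¹ → N/IⁿN`, `a ↦ δ(a)` (well defined as `δ(Iⁿ⁺¹) ⊆ IⁿN`).
[cite: StacksProject, Tag 07PE (1)] -/
def derivationAdicCompletion :
    Derivation ℤ (AdicCompletion I A) (AdicCompletion I N) :=
  Derivation.mk' (derivationAdicCompletionAddHom I δ).toIntLinearMap fun x y => by
    change derivationAdicCompletionFun I δ (x * y) =
      x • derivationAdicCompletionFun I δ y + y • derivationAdicCompletionFun I δ x
    ext n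
    rw [AdicCompletion.val_add_apply, AdicCompletion.smul_eval, AdicCompletion.smul_eval,
      derivationAdicCompletionFun_val I δ, derivationAdicCompletionFun_val I δ, derivationAdicCompletionFun_val I δ,
      AdicCompletion.val_mul, adicCompletion_val_eq_transitionMap_val_succ I x n,
      adicCompletion_val_eq_transitionMap_val_succ I y n]
    obtain ⟨a, ha⟩ := Ideal.Quotient.mk_surjective (x.val (n + 1))
    obtain ⟨b, hb⟩ := Ideal.Quotient.mk_surjective (y.val (n + 1))
    rw [← ha, ← hb, ← map_mul, derivationQuotPowMap_mk I δ, derivationQuotPowMap_mk I δ, derivationQuotPowMap_mk I δ,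
      Derivation.leibniz, Submodule.Quotient.mk_add]
    rfl

/-- Components of `δ^`. [folklore] -/
@[simp]
theorem derivationAdicCompletion_val (x : AdicCompletion I A) (n : ℕ) :
    (derivationAdicCompletion I δ x).val n = derivationQuotPowMap I δ n (x.val (n + 1)) :=
  rfl

/-- `δ^` extends `δ`: `δ^(â) = (δ a)^` for `a ∈ A`. [cite: StacksProject, Tag 07PE (1)] -/
@[simp]
theorem derivationAdicCompletion_of (a : A) :
    derivationAdicCompletion I δ (AdicCompletion.of I A a) = AdicCompletion.of I N (δ a) := by
  ext n
  rfl

/-- `δ^(a) = (δ a)^` for `a ∈ A`, with `A → Â` written as `algebraMap`. [folklore] -/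
theorem derivationAdicCompletion_algebraMap (a : A) :
    derivationAdicCompletion I δ (algebraMap A (AdicCompletion I A) a) = AdicCompletion.of I N (δ a) := by
  rw [AdicCompletion.algebraMap_apply, Algebra.algebraMap_self, RingHom.id_apply,
    derivationAdicCompletion_of I δ]

end Completion

/-! ## 3. Derivations of a tensor product from a compatible pair -/

section Pair

variable {R : Type u} [CommRing R] {A : Type v} [CommRing A] [Algebra R A] {C : Type w}
  [CommRing C] [Algebra R C] (dA : Derivation ℤ A (A ⊗[R] C)) (dC : Derivation ℤ C C)

/-- The bi-additive map `(a, c) ↦ (1 ⊗ c)·d_A(a) + a ⊗ d_C(c)`. [folklore] -/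
def pairDerivationBilin : A →+ C →+ A ⊗[R] C where
  toFun a :=
    { toFun := fun c => (1 : A) ⊗ₜ[R] c * dA a + a ⊗ₜ[R] dC c
      map_zero' := by simp
      map_add' := fun c c' => by
        simp only [tmul_add, map_add, add_mul]
        abel }
  map_zero' := by
    ext c
    simp
  map_add' a a' := by
    ext c
    simp only [map_add, mul_add, add_tmul, AddMonoidHom.coe_mk, ZeroHom.coe_mk,
      AddMonoidHom.add_apply]
    abel

/-- Unfolding `pairDerivationBilin`. [folklore] -/
@[simp]
theorem pairDerivationBilin_apply (a : A) (c : C) :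
    pairDerivationBilin dA dC a c = (1 : A) ⊗ₜ[R] c * dA a + a ⊗ₜ[R] dC c :=
  rfl

variable (hcomp : ∀ r : R, dA (algebraMap R A r) = (1 : A) ⊗ₜ[R] dC (algebraMap R C r))

include hcomp in
/-- The pair map is `R`-balanced when `d_A` and `d_C` agree on `R`. [folklore] -/
theorem pairDerivationBilin_smul (r : R) (a : A) (c : C) :
    pairDerivationBilin dA dC (r • a) c = pairDerivationBilin dA dC a (r • c) := by
  simp only [pairDerivationBilin_apply]
  have hA : dA (r • a) = r • dA a + a ⊗ₜ[R] dC (algebraMap R C r) := by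
    have h1 : dA (algebraMap R A r * a) =
        algebraMap R A r • dA a + a • dA (algebraMap R A r) := Derivation.leibniz _ _ _
    rw [Algebra.smul_def, h1, hcomp, algebraMap_smul, TensorProduct.smul_tmul', smul_eq_mul,
      mul_one]
  have hC : dC (r • c) = r • dC c + c * dC (algebraMap R C r) := by
    have h2 : dC (algebraMap R C r * c) =
        algebraMap R C r • dC c + c • dC (algebraMap R C r) := Derivation.leibniz _ _ _
    rw [Algebra.smul_def, h2, smul_eq_mul, smul_eq_mul, ← Algebra.smul_def]
  simp only [hA, hC, mul_add, tmul_add, TensorProduct.smul_tmul, TensorProduct.tmul_smul,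
    mul_smul_comm, smul_mul_assoc, Algebra.TensorProduct.tmul_mul_tmul, one_mul]
  abel

/-- The glued additive endomorphism of `A ⊗_R C`. [folklore] -/
def pairDerivationAddHom : A ⊗[R] C →+ A ⊗[R] C :=
  TensorProduct.liftAddHom (pairDerivationBilin dA dC) (pairDerivationBilin_smul dA dC hcomp)

/-- The glued map on pure tensors. [folklore] -/
@[simp]
theorem pairDerivationAddHom_tmul (a : A) (c : C) :
    pairDerivationAddHom dA dC hcomp (a ⊗ₜ[R] c) = (1 : A) ⊗ₜ[R] c * dA a + a ⊗ₜ[R] dC c :=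
  rfl

/-- In `A ⊗_R C`, the `A`-module action is multiplication by `a ⊗ 1`. [folklore] -/
theorem smul_eq_tmul_one_mul (a : A) (x : A ⊗[R] C) : a • x = a ⊗ₜ[R] (1 : C) * x := by
  rw [Algebra.smul_def, Algebra.TensorProduct.algebraMap_apply, Algebra.algebraMap_self,
    RingHom.id_apply]

/-- Leibniz rule for the glued map on pure tensors. [folklore] -/
theorem pairDerivationAddHom_tmul_mul_tmul (a a' : A) (c c' : C) :
    pairDerivationAddHom dA dC hcomp (a ⊗ₜ[R] c * a' ⊗ₜ[R] c') =
      a ⊗ₜ[R] c * pairDerivationAddHom dA dC hcomp (a' ⊗ₜ[R] c') +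
        a' ⊗ₜ[R] c' * pairDerivationAddHom dA dC hcomp (a ⊗ₜ[R] c) := by
  rw [Algebra.TensorProduct.tmul_mul_tmul, pairDerivationAddHom_tmul, pairDerivationAddHom_tmul,
    pairDerivationAddHom_tmul, Derivation.leibniz, Derivation.leibniz, smul_eq_tmul_one_mul,
    smul_eq_tmul_one_mul, smul_eq_mul, smul_eq_mul, tmul_add, mul_add, mul_add, mul_add]
  have e1 : (1 : A) ⊗ₜ[R] (c * c') * (a ⊗ₜ[R] (1 : C) * dA a') =
      a ⊗ₜ[R] c * ((1 : A) ⊗ₜ[R] c' * dA a') := by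
    rw [← mul_assoc, ← mul_assoc, Algebra.TensorProduct.tmul_mul_tmul,
      Algebra.TensorProduct.tmul_mul_tmul, one_mul, mul_one, mul_one]
  have e2 : (1 : A) ⊗ₜ[R] (c * c') * (a' ⊗ₜ[R] (1 : C) * dA a) =
      a' ⊗ₜ[R] c' * ((1 : A) ⊗ₜ[R] c * dA a) := by
    rw [← mul_assoc, ← mul_assoc, Algebra.TensorProduct.tmul_mul_tmul,
      Algebra.TensorProduct.tmul_mul_tmul, one_mul, mul_one, mul_one, mul_comm c' c]
  have e3 : (a * a') ⊗ₜ[R] (c * dC c') = a ⊗ₜ[R] c * (a' ⊗ₜ[R] dC c') := by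
    rw [Algebra.TensorProduct.tmul_mul_tmul]
  have e4 : (a * a') ⊗ₜ[R] (c' * dC c) = a' ⊗ₜ[R] c' * (a ⊗ₜ[R] dC c) := by
    rw [Algebra.TensorProduct.tmul_mul_tmul, mul_comm a a']
  rw [e1, e2, e3, e4]
  abel

/-- **A compatible pair of derivations glues to a derivation of `A ⊗_R C`**: given a derivation
`d_A : A → A ⊗_R C` (into the `A`-module `A ⊗_R C`) and a derivation `d_C : C → C` such that
`d_A(r) = 1 ⊗ d_C(r)` for `r ∈ R`, the map `a ⊗ c ↦ (1 ⊗ c)·d_A(a) + a ⊗ d_C(c)` is a well-defined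
derivation of the ring `A ⊗_R C` (`Der(A ⊗_R C) = Der(A) ×_{Der(R)} Der(C)`). [folklore] -/
def tensorProductDerivation : Derivation ℤ (A ⊗[R] C) (A ⊗[R] C) :=
  Derivation.mk' (pairDerivationAddHom dA dC hcomp).toIntLinearMap fun x y => by
    change pairDerivationAddHom dA dC hcomp (x * y) =
      x • pairDerivationAddHom dA dC hcomp y + y • pairDerivationAddHom dA dC hcomp x
    rw [smul_eq_mul, smul_eq_mul]
    induction x using TensorProduct.induction_on with
    | zero => simp
    | tmul a c =>
      induction y using TensorProduct.induction_on with
      | zero => simp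
      | tmul a' c' => exact pairDerivationAddHom_tmul_mul_tmul dA dC hcomp a a' c c'
      | add y y' hy hy' =>
        rw [mul_add, map_add, hy, hy', map_add, add_mul, mul_add]
        abel
    | add x x' hx hx' =>
      rw [add_mul, map_add, hx, hx', map_add, add_mul, mul_add]
      abel

/-- The glued derivation on pure tensors. [folklore] -/
@[simp]
theorem tensorProductDerivation_tmul (a : A) (c : C) :
    tensorProductDerivation dA dC hcomp (a ⊗ₜ[R] c) =
      (1 : A) ⊗ₜ[R] c * dA a + a ⊗ₜ[R] dC c :=
  rfl

/-- On `1 ⊗ c` the glued derivation is `1 ⊗ d_C(c)`. [folklore] -/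
theorem tensorProductDerivation_one_tmul (c : C) :
    tensorProductDerivation dA dC hcomp ((1 : A) ⊗ₜ[R] c) =
      (1 : A) ⊗ₜ[R] dC c := by
  simp

/-- On `a ⊗ 1` the glued derivation is `d_A(a)`. [folklore] -/
theorem tensorProductDerivation_tmul_one (a : A) :
    tensorProductDerivation dA dC hcomp (a ⊗ₜ[R] (1 : C)) = dA a := by
  simp [← Algebra.TensorProduct.one_def]

end Pair

end Literature.AlgebraicGeometry.Resolution

end
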